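import Summits.AnomalousDissipation.AnomalousDissipation.Theorems.CoherentFractionInvariantExtremeClimatesPlanar.Negative.CrossflowRoots
import Summits.AnomalousDissipation.AnomalousDissipation.Theorems.SoloInformedDriftRateCeiling
import Literature.Analysis.FluidPDE.DoeringFoiasProofs
import Literature.Analysis.FluidPDE.LongTimeAveragePeriodic
import Literature.Analysis.FluidPDE.StokesTorusProofs
import Literature.Analysis.FunctionSpaces.TorusClassicalNSUniqueness
import Literature.Analysis.FunctionSpaces.TorusFourierCalculus
import HarnessLib

/-!
# Inviscid roots are invisible to viscous climates
# (negative lane of `CoherentFraction.BoundedQuietPlanarity`, stmt-AnomalousDissipation-33307)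

The only explicit NON-PLANAR bounded states of record for the route's Kolmogorov force
`f_K = sin(4πx₁) e₀` are the crossed-shear roots `v_t` (`…/CoherentFractionInvariantExtremeClimatesPlanar/
Negative/CrossflowRoots`): smooth mean-zero divergence-free classical roots of the steady Euler
equation WITH DRIFT `(v·∇)v + Dv·m + ∇p = f_K` (`crossedShear_momentumT`), one at every cross-flow
`m = p e₁`, `p ≠ 0`.  They killed the four Liouville / climate items of the cone (28522, 27427, 27871,
28074).  This file records, kernel-checked, why they can NOT serve as the «quiet non-planar family»
against the VISCOUS items `BoundedQuietPlanarity` 33307, `TameQuietPlanarity` 27440,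
`BoundedNonPlanarCoherentStates` 33798 (which quantify over global Leray–Hopf solutions of
`NS_ν(f_K)`): a steady Leray–Hopf state pays its enstrophy in power, `ν‖∇W‖₂² ≤ (f, W)`
(`steady_dissipation_le_power`, the tree's Doering–Foias bound `⟨ν‖∇u‖²⟩ ≤ ⟨(f,u)⟩` on a constant
trajectory, means by `meanDissipation_of_const` / `meanPower_steady`), whereas EVERY smooth Euler(+drift) root is POWERLESS, `(f, W) = 0`
(`integral_inner_eq_zero_of_eulerDriftRoot`: the three terms `∫⟪(W·∇)W, W⟫`, `∫⟪DW·m, W⟫`, `∫⟪∇q, W⟫`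
vanish by antisymmetry and incompressibility).  Hence (Poincaré on `H`) a smooth Euler(+drift) root is
a Leray–Hopf steady state of `NS_ν(f)` for NO `ν > 0` unless it vanishes identically
(`eulerDriftRoot_not_isGlobalLerayHopf`); in particular no crossed-shear root `v_t`, `t ≠ 0`, is a
viscous steady state at any viscosity (`vfieldT_not_isGlobalLerayHopf`).  A viscous kill of 33307 /
27440 or a proof of 33798 therefore needs states that ABSORB power — the census' open door
(«viscosity-selected non-planar root», QuietRootFloor barrier) is untouched by the inviscid family.
[folklore; Doering–Foias 2002 §2 for the power bound]
-/

noncomputable section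

-- `Summit.<Summit>.<Problem>` is the tree's mandated summit-side namespace (CONVENTIONS §2); for this
-- single-conjunct summit the two segments coincide, so the duplicate is deliberate.
set_option linter.dupNamespace false

namespace Summit.AnomalousDissipation.AnomalousDissipation.Theorems.CrossedShearRoot

open Real MeasureTheory Filter
open scoped InnerProductSpace ENNReal
open Literature.Analysis.FunctionSpaces Literature.Analysis.FunctionSpaces.Torus Literature.Analysis.FluidPDE

/-! ## Long-time means of a steady trajectory -/

/-- The mean injected power of a steady trajectory is the instantaneous power `(f, W)`. [folklore] -/
theorem meanPower_steady (f W : UnitAddTorus (Fin 3) → EuclideanSpace ℝ (Fin 3)) :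
    meanPower f (fun _ : ℝ => W) = ∫ x, ⟪f x, W x⟫_ℝ := by
  rw [meanPower_eq, longTimeAvgSup_eq_of_periodic (τ := 1) (fun _ => rfl) one_pos]
  simp

/-! ## Kernel: a steady Leray–Hopf state pays its enstrophy in power -/

/-- **Steady energy inequality.** If the constant trajectory `t ↦ W` is a global Leray–Hopf solution of
`NS_ν(f)` (`ν > 0`, `f ∈ L²` mean zero) then `ν‖∇W‖₂² ≤ (f, W)` — the Doering–Foias bound
`⟨ν‖∇u‖₂²⟩ ≤ ⟨(f, u)⟩` (`DoeringFoias2002_dissipation_le_power_holds`) read on a steady trajectory.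
[cite: CheskidovDoeringPetrov2006, eq. (11)] -/
theorem steady_dissipation_le_power {ν : ℝ} (hν : 0 < ν) {f : UnitAddTorus (Fin 3) → EuclideanSpace ℝ (Fin 3)}
    (hf : MemLp f 2 volume) (hf0 : HasZeroMean f) {u₀ W : UnitAddTorus (Fin 3) → EuclideanSpace ℝ (Fin 3)}
    (hW : Torus.IsGlobalLerayHopf ν (fun _ => f) u₀ (fun _ => W)) :
    ν * (eGradNormSq W).toReal ≤ ∫ x, ⟪f x, W x⟫_ℝ := by
  have h := DoeringFoias2002_dissipation_le_power_holds hν hf hf0 u₀ (fun _ => W) hW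
  rwa [meanDissipation_of_const, meanPower_steady] at h

/-- A steady Leray–Hopf state has finite enstrophy (`∫₀¹ ‖∇W‖₂² dt = ‖∇W‖₂² < ∞`). [folklore] -/
theorem eGradNormSq_lt_top_of_steady {ν : ℝ} {f u₀ W : UnitAddTorus (Fin 3) → EuclideanSpace ℝ (Fin 3)}
    (hW : Torus.IsGlobalLerayHopf ν (fun _ => f) u₀ (fun _ => W)) : eGradNormSq W < ⊤ := by
  have h := (hW 1 one_pos).lintegral_eGradNormSq_lt_top
  simp only [setLIntegral_const, Real.volume_Ioo, sub_zero, ENNReal.ofReal_one, mul_one] at h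
  exact h

/-- **Powerless steady Leray–Hopf states are gradient-free**: `(f, W) ≤ 0` forces `‖∇W‖₂² = 0`. [folklore] -/
theorem eGradNormSq_eq_zero_of_steady_powerless {ν : ℝ} (hν : 0 < ν)
    {f : UnitAddTorus (Fin 3) → EuclideanSpace ℝ (Fin 3)} (hf : MemLp f 2 volume) (hf0 : HasZeroMean f)
    {u₀ W : UnitAddTorus (Fin 3) → EuclideanSpace ℝ (Fin 3)}
    (hW : Torus.IsGlobalLerayHopf ν (fun _ => f) u₀ (fun _ => W)) (hP : ∫ x, ⟪f x, W x⟫_ℝ ≤ 0) :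
    eGradNormSq W = 0 := by
  have h1 := steady_dissipation_le_power hν hf hf0 hW
  have h2 : (eGradNormSq W).toReal = 0 := by
    have h0 : 0 ≤ (eGradNormSq W).toReal := ENNReal.toReal_nonneg
    nlinarith
  rcases (ENNReal.toReal_eq_zero_iff _).1 h2 with h | h
  · exact h
  · exact absurd h (eGradNormSq_lt_top_of_steady hW).ne

/-- **Poincaré step**: a powerless steady Leray–Hopf state representing a state of `H` vanishes a.e.
(`‖V‖² ≤ ‖∇V‖₂² = 0`, `Torus.enorm_sq_le_eGradNormSq`). [folklore] -/
theorem ae_eq_zero_of_steady_powerless {ν : ℝ} (hν : 0 < ν)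
    {f : UnitAddTorus (Fin 3) → EuclideanSpace ℝ (Fin 3)} (hf : MemLp f 2 volume) (hf0 : HasZeroMean f)
    {u₀ W : UnitAddTorus (Fin 3) → EuclideanSpace ℝ (Fin 3)}
    (hW : Torus.IsGlobalLerayHopf ν (fun _ => f) u₀ (fun _ => W)) (hP : ∫ x, ⟪f x, W x⟫_ℝ ≤ 0)
    (V : energySpace (Fin 3)) (hV : rep V =ᵐ[volume] W) : W =ᵐ[volume] 0 := by
  have h0 := eGradNormSq_eq_zero_of_steady_powerless hν hf hf0 hW hP
  have hPoinc := Literature.Analysis.FluidPDE.Torus.enorm_sq_le_eGradNormSq V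
  have hcongr : eGradNormSq (rep V) = eGradNormSq W := eGradNormSq_congr_ae hV
  rw [hcongr, h0, nonpos_iff_eq_zero, pow_eq_zero_iff two_ne_zero] at hPoinc
  have hn : ‖V‖ₑ = ‖(V : Lp (EuclideanSpace ℝ (Fin 3)) 2 (volume : Measure (UnitAddTorus (Fin 3))))‖ₑ := rfl
  rw [hn] at hPoinc
  have hL : (V : Lp (EuclideanSpace ℝ (Fin 3)) 2 (volume : Measure (UnitAddTorus (Fin 3)))) = 0 :=
    enorm_eq_zero.1 hPoinc
  have hz : rep V =ᵐ[volume] 0 := by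
    show ((V : Lp (EuclideanSpace ℝ (Fin 3)) 2 (volume : Measure (UnitAddTorus (Fin 3)))) :
      UnitAddTorus (Fin 3) → EuclideanSpace ℝ (Fin 3)) =ᵐ[volume] 0
    rw [hL]
    exact Lp.coeFn_zero _ _ _
  exact hV.symm.trans hz

/-- **Smooth form.** A smooth mean-zero divergence-free field `W ≠ 0` with `(f, W) ≤ 0` is a
Leray–Hopf steady state of `NS_ν(f)` for no `ν > 0`. [folklore] -/
theorem eq_zero_of_steady_powerless {ν : ℝ} (hν : 0 < ν)
    {f : UnitAddTorus (Fin 3) → EuclideanSpace ℝ (Fin 3)} (hf : MemLp f 2 volume) (hf0 : HasZeroMean f)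
    {u₀ W : UnitAddTorus (Fin 3) → EuclideanSpace ℝ (Fin 3)} (hWs : IsSmooth W) (hdiv : IsDivFree W)
    (hzm : HasZeroMean W) (hW : Torus.IsGlobalLerayHopf ν (fun _ => f) u₀ (fun _ => W))
    (hP : ∫ x, ⟪f x, W x⟫_ℝ ≤ 0) : W = 0 := by
  have hmem : (hWs.memLp 2).toLp W ∈ Torus.smoothSolenoidal (Fin 3) :=
    ⟨W, hWs, hdiv, hzm, MemLp.coeFn_toLp (hWs.memLp 2)⟩
  have hae : W =ᵐ[volume] 0 :=
    ae_eq_zero_of_steady_powerless hν hf hf0 hW hP ⟨(hWs.memLp 2).toLp W, Torus.smoothSolenoidal_subset_energySpace hmem⟩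
      (MemLp.coeFn_toLp (hWs.memLp 2))
  exact (hWs.continuous.ae_eq_iff_eq volume continuous_const).1 hae

/-! ## Euler(+drift) roots are powerless -/

/-- **Inviscid roots inject no power.** For a smooth divergence-free `W`, a smooth pressure `q` and a
constant drift `m` with `(W·∇)W + DW·m + ∇q = f` pointwise: `(f, W) = 0` — each of
`∫⟪(W·∇)W, W⟫`, `∫⟪DW·m, W⟫ = ∫⟪(m·∇)W, W⟫`, `∫⟪∇q, W⟫` vanishes (antisymmetry of the trilinear form,
`div W = 0`). [folklore] -/
theorem integral_inner_eq_zero_of_eulerDriftRoot {f W : UnitAddTorus (Fin 3) → EuclideanSpace ℝ (Fin 3)}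
    {q : UnitAddTorus (Fin 3) → ℝ} (hWs : IsSmooth W) (hdiv : IsDivFree W) (hq : IsSmooth q)
    (m : EuclideanSpace ℝ (Fin 3))
    (hroot : ∀ x, Torus.convect W W x + Torus.fderiv W x m + Torus.gradient q x = f x) :
    ∫ x, ⟪f x, W x⟫_ℝ = 0 := by
  have hc : IsDivFree (fun _ : UnitAddTorus (Fin 3) => m) := by
    intro x; unfold divergence; simp [Torus.partialDeriv, Torus.lineDeriv]
  have h1 : ∫ x, ⟪Torus.convect W W x, W x⟫_ℝ = 0 := integral_inner_convect_self_eq_zero hWs hdiv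
  have h2 : ∫ x, ⟪Torus.fderiv W x m, W x⟫_ℝ = 0 :=
    integral_inner_convect_self_right_eq_zero (isSmooth_const m) hc hWs
  have h3 : ∫ x, ⟪Torus.gradient q x, W x⟫_ℝ = 0 := integral_inner_gradient_eq_zero_of_isDivFree hWs hq hdiv
  have i1 : Integrable (fun x => ⟪Torus.convect W W x, W x⟫_ℝ) volume := ((hWs.convect hWs).inner hWs).integrable
  have i2 : Integrable (fun x => ⟪Torus.fderiv W x m, W x⟫_ℝ) volume :=
    (((isSmooth_const m).convect hWs).inner hWs).integrable
  have i3 : Integrable (fun x => ⟪Torus.gradient q x, W x⟫_ℝ) volume := (hq.gradient.inner hWs).integrable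
  have i12 : Integrable (fun x => ⟪Torus.convect W W x, W x⟫_ℝ + ⟪Torus.fderiv W x m, W x⟫_ℝ) volume := i1.add i2
  calc ∫ x, ⟪f x, W x⟫_ℝ
      = ∫ x, (⟪Torus.convect W W x, W x⟫_ℝ + ⟪Torus.fderiv W x m, W x⟫_ℝ + ⟪Torus.gradient q x, W x⟫_ℝ) := by
        refine integral_congr_ae (ae_of_all _ fun x => ?_)
        show ⟪f x, W x⟫_ℝ = _
        rw [← hroot x, inner_add_left, inner_add_left]
    _ = (∫ x, ⟪Torus.convect W W x, W x⟫_ℝ) + (∫ x, ⟪Torus.fderiv W x m, W x⟫_ℝ) +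
          ∫ x, ⟪Torus.gradient q x, W x⟫_ℝ := by rw [integral_add i12 i3, integral_add i1 i2]
    _ = 0 := by rw [h1, h2, h3]; ring

/-- **INVISCID ROOTS ARE INVISIBLE TO VISCOUS CLIMATES.** A smooth mean-zero divergence-free
classical root `W ≠ 0` of the steady Euler equation with drift, `(W·∇)W + DW·m + ∇q = f` (`f ∈ L²`
mean zero), is a Leray–Hopf steady state of `NS_ν(f)` for NO viscosity `ν > 0` and no initial datum:
`ν‖∇W‖₂² ≤ (f, W) = 0` would force `W = 0`. [folklore] -/
theorem eulerDriftRoot_not_isGlobalLerayHopf {f W : UnitAddTorus (Fin 3) → EuclideanSpace ℝ (Fin 3)}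
    {q : UnitAddTorus (Fin 3) → ℝ} {m : EuclideanSpace ℝ (Fin 3)} (hf : MemLp f 2 volume) (hf0 : HasZeroMean f)
    (hWs : IsSmooth W) (hdiv : IsDivFree W) (hzm : HasZeroMean W) (hq : IsSmooth q)
    (hroot : ∀ x, Torus.convect W W x + Torus.fderiv W x m + Torus.gradient q x = f x) (hW0 : W ≠ 0)
    {ν : ℝ} (hν : 0 < ν) (u₀ : UnitAddTorus (Fin 3) → EuclideanSpace ℝ (Fin 3)) :
    ¬ Torus.IsGlobalLerayHopf ν (fun _ => f) u₀ (fun _ => W) := fun hLH =>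
  hW0 (eq_zero_of_steady_powerless hν hf hf0 hWs hdiv hzm hLH
    (integral_inner_eq_zero_of_eulerDriftRoot hWs hdiv hq m hroot).le)

/-! ## The crossed-shear roots `v_t` -/

/-- `f_K` has zero mean. [folklore] -/
theorem hasZeroMean_fK : HasZeroMean fK :=
  Literature.Analysis.FluidPDE.Torus.hasZeroMean_stokesMode (k := (![0, 2, 0] : Fin 3 → ℤ))
    (by intro h; simpa using congrFun h 1) _ _

variable {t : ℝ}

/-- `v_t ≠ 0` for `t ≠ 0` (its first component at the origin is `t⁻¹ · (2/3)`). [folklore] -/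
theorem vfieldT_ne_zero (ht : t ≠ 0) : vfieldT t ≠ 0 := by
  intro h
  have h0 : vfieldT t (proj 0) 0 = 0 := by rw [congrFun h (proj 0)]; simp
  rw [vfieldT_proj_apply] at h0
  norm_num [c4, rho] at h0
  exact ht h0

/-- **The crossed-shear roots are powerless**: `(f_K, v_t) = 0` for every `t ≠ 0`. [folklore] -/
theorem integral_inner_fK_vfieldT (ht : t ≠ 0) : ∫ x, ⟪fK x, vfieldT t x⟫_ℝ = 0 :=
  integral_inner_eq_zero_of_eulerDriftRoot (isSmooth_vfieldT t) (isDivFree_vfieldT t) isSmooth_pres (driftT t)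
    (crossedShear_momentumT ht)

/-- **NO CROSSED-SHEAR ROOT IS A VISCOUS STEADY STATE.** For every `t ≠ 0`, every `ν > 0` and every
initial datum `u₀`, the constant trajectory `v_t` is NOT a global Leray–Hopf solution of `NS_ν(f_K)`:
the explicit non-planar root family of the cone (roots at every cross-flow `p e₁`, `p ≠ 0`) carries
no viscous climate at any viscosity. [folklore] -/
theorem vfieldT_not_isGlobalLerayHopf (ht : t ≠ 0) {ν : ℝ} (hν : 0 < ν)
    (u₀ : UnitAddTorus (Fin 3) → EuclideanSpace ℝ (Fin 3)) :
    ¬ Torus.IsGlobalLerayHopf ν (fun _ => fK) u₀ (fun _ => vfieldT t) :=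
  eulerDriftRoot_not_isGlobalLerayHopf (isSmooth_fK.memLp 2) hasZeroMean_fK (isSmooth_vfieldT t)
    (isDivFree_vfieldT t) (hasZeroMean_vfieldT t) isSmooth_pres (crossedShear_momentumT ht) (vfieldT_ne_zero ht) hν u₀

/-- The same with the force spelled as in the route items 33307 / 27440 / 33798
(`f_K = stokesMode (0,2,0) e₀ false`). [folklore] -/
theorem vfieldT_not_isGlobalLerayHopf_stokesMode (ht : t ≠ 0) {ν : ℝ} (hν : 0 < ν)
    (u₀ : UnitAddTorus (Fin 3) → EuclideanSpace ℝ (Fin 3)) :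
    ¬ Torus.IsGlobalLerayHopf ν
      (fun _ => ⇑(Literature.Analysis.FluidPDE.Torus.stokesMode (![0, 2, 0] : Fin 3 → ℤ)
        (EuclideanSpace.single (0 : Fin 3) (1 : ℝ)) false)) u₀ (fun _ => vfieldT t) :=
  vfieldT_not_isGlobalLerayHopf ht hν u₀

end Summit.AnomalousDissipation.AnomalousDissipation.Theorems.CrossedShearRoot

end
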